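import Summits.ABC.ABC.Theses.IsogenyGlueCongruence
import Summits.ABC.ABC.Theorems.IsogenyGlueCongruenceEllipticGluingPrimeBoundOfSimpleThree
import Summits.ABC.ABC.Theorems.IsogenyGlueCongruenceEllipticGluingPrimeBoundStubCMTorsionCartanImage
import Literature.NumberTheory.EllipticCurves.MasserWustholzSurjectivity
import HarnessLib

/-!
# Crux U `EllipticGluingPrimeBound` (stmt-ABC-13919) — line `Sketch` (isotypic–Minkowski
# reduction), skeleton v14 (continuation lead c3, cycle 5)

Lead prover's SKELETON for the line of idea card `Ideas/isotypic-minkowski-reduction.md`.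
The crux (verbatim the route decl
`Summit.ABC.ABC.Theses.IsogenyGlueCongruence.EllipticGluingPrimeBound`) is concluded BY NAME by
`ellipticGluingPrimeBound_proof`, in ONE line through the LANDED composition
`ellipticGluingPrimeBound_of_simple` (Theorems/…OfSimpleThree.lean, p118731); `sorry` occurs only in
the THREE registered stubs `stub_*`, all written in tree vocabulary.

## State (cycles 1–4, leads -0 / c1 / c2): U ⟺ U_simple modulo three published inputs

All structural stubs of the line are LANDED and enter through the imported composition:
`stub_minkowski` p85944 · `stub_invariantPairing` p85871 · `stub_caseB` p88096 ·
`stub_isotypicDichotomy` p89490 · `stub_geomIsotypicSplitting` p90952 · `stub_isotypicBranchPolyOf`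
p94311 · `stub_rationalPartReduction` p95095 · `stub_bigImageTorsionCore` p96522 ·
`stub_CMTorsionCoreOf` p112893 · `stub_CMIsotypicCoreOf` p115225 · `stub_irreducibleThreshold` p117030 ·
`stub_dichotomyOfIrreducible` p117046 · `stub_quotientByAbelianSubvariety` p117597 · `stub_freeOfSimple`
p117567; reductions p115578 (4 facts + U_free ⟹ U), p117349 (3 inputs + U_free ⟹ U), p118731
(3 inputs + U_simple ⟹ U, and `ellipticGluingPrimeBound_iff_simple`); converses p117323 (U ⟹ U_free)
and p117529 (U ⟹ U_simple), both unconditional.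

## v13 → v14 (this cycle): composition imported; the CM input DISCHARGED

v13 = v12 with the composition imported from p118731 instead of proved inline (four stubs).
v14: the CM torsion fact `cmTorsion_cartanImage` has been PROVED in the tree by the literature
programme (`Literature.NumberTheory.EllipticCurves.cmTorsion_cartanImage_holds`, Serre 1972
§1.11/§4.5 route, standard axioms), and the registered stub `stub_cmTorsionCartanImage` is LANDED
through it (…StubCMTorsionCartanImage.lean, p119892) and imported here.  Also landed this cycle:
the `d = 1` slice certificate `fixedCurveTorsionSharing_of_ellipticGluingPrimeBound`
(U ⟹ fixed-curve torsion sharing uniform in the partner curve; …FixedCurveSlice.lean, p119856).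
The three remaining stubs:

* `stub_masserWustholzSurjective` — NAMED FACT (Masser–Wüstholz 1993 Thm (b)), unproved; the
  tree now derives it from Mazur 1978 Cor. 4.4 (`Mazur1978.cor44_valuation_j_le_one`, the one
  remaining input of `mazur_isogeny_irreducible`, Prop. 5.1 being proved) and the Gaudron–Rémond
  pair isogeny theorem (`GaudronRemond2023_torsionHom_ellipticPair`):
  `masserWustholz_surjective_modEll_of_mazur_of_gaudronRemond`
  (MasserWustholzOfGaudronRemondProofs) — so its trust base is the pair {Cor. 4.4, GR pairs},
  shared with the route's other lines;
* `stub_faltingsTate : FaltingsTate` — the route ITEM stmt-ABC-15664 (Faltings 1983; in the tree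
  reduced to Finiteness I), verbatim; NECESSARY in kind (planner's phantom-model argument);
* `stub_simpleFreeTorsionBound` = `U_simple` — THE BET: open problem of generalized Frey–Mazur type,
  crux-EQUIVALENT modulo the inputs (both directions landed: p118731 ⟸, p117529 ⟹).

Disproof used (`Cruxes/EllipticGluingPrimeBound/Disproof.lean`, cycle 1 final, re-read this cycle):
`iff_boundAbove` / `iff_normalised` (thresholds absorbed inside `bound_of_branches₃`),
`_false_without_forallDvd` / `_false_without_neZero` (both hypotheses threaded), §2 structural
reduction (both directions formal), F5/F6/F9/F10 (why `U_simple` is the honest residual),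
`one_le_kappa_of_weilRestrictionFamily` (no stub claims `κ < 1`). §3 Targets: none registered.
-/

noncomputable section

-- `Summit.<Summit>.<Problem>` is the mandated summit-side namespace (CONVENTIONS §2); for the
-- single-conjunct summit `ABC` the two coincide, so the duplicate `ABC.ABC` is deliberate.
set_option linter.dupNamespace false

namespace Summit.ABC.ABC.Theorems.IsotypicMinkowski

open CategoryTheory CategoryTheory.Limits AlgebraicGeometry
open Literature.AlgebraicGeometry.Motives
open Summit.ABC.ABC.Theses.IsogenyGlueCongruence

/-! ### Registered stubs (`sorry` only here; statements in tree vocabulary only) -/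

/-- STUB (MW — NAMED FACT `Literature.NumberTheory.EllipticCurves.masserWustholz_surjective_modEll`,
Masser–Wüstholz 1993, effective surjectivity over `ℚ` in the stable-Faltings-height form; landed as
an UNPROVED Literature fact p94240; the line is CONDITIONAL on it — blocked-on its discharge):
for `W/ℚ` without geometric CM and every prime `ℓ > c · max(1, h_F(W))^γ` the mod-`ℓ`
representation is surjective. -/
theorem stub_masserWustholzSurjective :
    Literature.NumberTheory.EllipticCurves.masserWustholz_surjective_modEll := by
  sorry

/-! `stub_cmTorsionCartanImage` (FACT 2, the CM torsion fact) is LANDED (p119892, by the tree's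
discharge `cmTorsion_cartanImage_holds`) and imported. -/

/-- STUB = the route ITEM `FaltingsTate` (stmt-ABC-15664, crux rank 9, KNOWN in print: Faltings 1983
Satz 4 — Tate's conjecture for homomorphisms of abelian varieties over `ℚ`).  Used ONLY to see the CM
endomorphism `√D` on the abstract model `E` of the crux (CM torsion core).  Spelled against the
item verbatim: the line is conditional on that ITEM, not on an apex fact. -/
theorem stub_faltingsTate : FaltingsTate := by
  sorry

/-- STUB (THE BET = `U_simple` — open problem, generalized Frey–Mazur core, sharpened):
height-free torsion sharing with **ℚ-SIMPLE** geometrically `E`-free partners at primes where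
`W[ℓ]` is irreducible is polynomially bounded: absolute `κ ≥ 0`, `C` with
`ℓ ≤ C · ((dim A + 1) · max(1, h_F(W)))^κ` whenever `A/ℚ` is simple, `Hom_ℚ̄(E, A) = 0`, `W[ℓ]`
is an irreducible `Γ_ℚ`-module and `W[ℓ] ↪ A(ℚ̄)` `Γ_ℚ`-equivariantly.  EQUIVALENT to the crux
modulo the three inputs: `U → U_simple` is landed unconditionally (p117529) and
`U_simple → U` given the inputs is `ellipticGluingPrimeBound_of_simple` (p118731). -/
theorem stub_simpleFreeTorsionBound :
    ∃ κ C : ℝ, 0 ≤ κ ∧ ∀ (W : WeierstrassCurve ℚ) [W.IsElliptic] (E A : AbelianVariety.{0} ℚ)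
      (e : E.geomPoints ≃+ W.geomPoints),
      (∀ (σ : Field.absoluteGaloisGroup ℚ) (P : E.geomPoints), e (σ • P) = σ • e P) →
      (∀ f : E.baseChange (AlgebraicClosure ℚ) ⟶ A.baseChange (AlgebraicClosure ℚ), f = 0) →
      AbelianVariety.IsSimple A →
      ∀ ℓ : ℕ, ℓ.Prime → W.HasIrreducibleModPGaloisRep ℓ →
      (∃ ι : W.geomTorsion ℓ →+ A.geomPoints, Function.Injective ι ∧
        ∀ (σ : Field.absoluteGaloisGroup ℚ) (P : W.geomTorsion ℓ), ι (σ • P) = σ • ι P) →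
        (ℓ : ℝ) ≤ C * (((A.dim : ℝ) + 1) * max 1 W.stableFaltingsHeight) ^ κ := by
  sorry

/-! ### The crux, by name (composition landed: p118731) -/

/-- **The crux, concluded by name through the line** (closed modulo the registered stubs):
`EllipticGluingPrimeBound` from the Masser–Wüstholz fact, the CM torsion fact (LANDED), the route
item `FaltingsTate` and `U_simple`, by the landed reduction theorem
`ellipticGluingPrimeBound_of_simple` (threshold supply + dichotomy-given-irreducibility +
polynomial isotypic bound + free bound along ℚ-simple partners, `bound_of_branches₃`). -/
theorem ellipticGluingPrimeBound_proof : EllipticGluingPrimeBound :=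
  ellipticGluingPrimeBound_of_simple stub_masserWustholzSurjective stub_cmTorsionCartanImage
    stub_faltingsTate stub_simpleFreeTorsionBound

end Summit.ABC.ABC.Theorems.IsotypicMinkowski

end
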